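import Literature.NumberTheory.Sieve.BombieriFriedlanderIwaniecTheorem7StarSieve
import HarnessLib

/-!
# Bombieri–Friedlander–Iwaniec 1986: Theorem 7* from Theorem 7 (the sieve extension, assembled)

Topic `Literature/NumberTheory/Sieve`, continuation of
`Literature.NumberTheory.Sieve.BombieriFriedlanderIwaniecTheorem7StarSieve`.  Everything here is
PROVED; no named fact is introduced.

BFI, §14, p. 246: "THEOREM 7. If (14.5) and (14.6) hold, then we have (14.1)
[`Δ(M,N,L,Q,R) ≪ x^{1−ε}`]. As in Section 12, using Lemma 4 we can extend the result to sums
`Δ*(M, N, L, Q, R)` say, where the variables `l, m, n` are free of prime factors `p < z (≤ z₀)`.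
This gives THEOREM 7*. If (14.5) and (14.6) hold then `Δ*(M, N, L, Q, R) ≪ x(log x)^{−A}`."

Main result: `BombieriFriedlanderIwaniecTheorem7Star.restricted_of_smooth` — in the regime
`Q²R ≤ x` of (14.4) (the complementary regime is reduced to this one by the `q ↔ s` symmetry of
§13, not formalised here), the statement of the named fact
`Literature.NumberTheory.Sieve.BombieriFriedlanderIwaniecTheorem7Star` FOLLOWS from Theorem 7 for
unsieved variables with a power saving (taken as an explicit hypothesis, in the same regime and
with the level condition `QR < xℒ^{−B}`; it is what §14 proves from Lemmas 1, 2 — Lemma 1 being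
Deshouillers–Iwaniec's bound for sums of Kloosterman sums).  The extension is the printed one, made
effective with the two-range composite sieve of the tree (`TwoRangeSieve`, Fundamental Lemma of
quality `exp(−s log s)`, exactly as for Theorem 5* in
`…BombieriFriedlanderIwaniecTheorem5StarFromTheorem5`), applied to BOTH smooth variables through
`BFI.deltaW_rough_rough_le` when `N > x^{ε_s/2}`, and — when `n` is too short to be sieved with an
admissible remainder — to `m` alone after merging `n` into `l` (`BFI.deltaStar_le_deltaW_merge`,
which keeps `x = LMN`).  The pieces of the sieve are sums `Δ` at `(M/d, N/e, L·de, Q, R)` with the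
same `x` and the same moduli, to which Theorem 7 applies with `ε/2` in (14.5)–(14.6).

## References

* E. Bombieri, J. B. Friedlander, H. Iwaniec, *Primes in arithmetic progressions to large moduli*,
  Acta Math. 156 (1986), 203–251: §2 Lemma 4 p. 211; §12 p. 238; §14 (14.4)–(14.6), Theorems 7, 7*
  p. 246. [BombieriFriedlanderIwaniecActa1986]
-/

open Finset Real
open scoped ArithmeticFunction.sigma

namespace Literature.NumberTheory.Sieve

namespace BFI

/-! ### The smooth pieces are sums `Δ` -/

/-- With all weights `1`, `deltaW` is the unsieved sum `Δ = Δ*` at `z = 2`. [folklore] -/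
theorem deltaW_one_eq_deltaStar_two (a : ℤ) (M N L Q R : ℝ) :
    deltaW a M N L Q R (fun _ => 1) (fun _ => 1) (fun _ => 1) = deltaStar a 2 M N L Q R := by
  have h : roughIndicator 2 = fun _ : ℕ => (1 : ℝ) := funext (roughIndicator_of_le_two le_rfl)
  rw [deltaStar_eq_deltaW, h]

/-- With `N = 1` the weight on `n ∈ {1}` is irrelevant as long as its value at `1` is `1`. [folklore] -/
theorem deltaW_N_one_rough (a : ℤ) (z M L Q R : ℝ) (ωl ωm : ℕ → ℝ) :
    deltaW a M 1 L Q R ωl ωm (roughIndicator z) = deltaW a M 1 L Q R ωl ωm (fun _ => 1) := by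
  refine deltaW_congr (fun _ _ => rfl) fun n hn => ?_
  rw [Nat.floor_one, Finset.Icc_self, Finset.mem_singleton] at hn
  rw [hn, roughIndicator_one]

/-! ### Sizes of the sieve parameters -/

/-- `z₀ = exp(log x / log log x) ≥ 2` once `x ≥ e^e`. [folklore] -/
theorem two_le_z0 {x : ℝ} (hx : Real.exp (Real.exp 1) ≤ x) :
    2 ≤ Real.exp (Real.log x / Real.log (Real.log x)) := by
  have he : (2.7 : ℝ) < Real.exp 1 := by have := Real.exp_one_gt_d9; linarith
  have hx0 : 0 < x := (Real.exp_pos _).trans_le hx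
  have hL : Real.exp 1 ≤ Real.log x := by rw [Real.le_log_iff_exp_le hx0]; exact hx
  have hL0 : 0 < Real.log x := by linarith
  have hll1 : 1 ≤ Real.log (Real.log x) := by rw [Real.le_log_iff_exp_le hL0]; exact hL
  have hll : Real.log (Real.log x) ≤ Real.log x := (Real.log_le_sub_one_of_pos hL0).trans (by linarith)
  have h1 : 1 ≤ Real.log x / Real.log (Real.log x) := by
    rw [le_div_iff₀ (by linarith)]; linarith
  calc (2 : ℝ) ≤ Real.exp 1 := by linarith
    _ ≤ Real.exp (Real.log x / Real.log (Real.log x)) := Real.exp_le_exp.2 h1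

/-- The mass of the weights: `N_w ≤ 4 x^{3ε_s/8}` when `D₁ = x^{ε_s/8}`, `z'^{2r+1} ≤ x^{ε_s/8}`,
`z' ≥ 2`, `x ≥ 1`. [folklore] -/
theorem sieveMass_le {x εs z' z₁ : ℝ} {rr : ℕ} (hx1 : 1 ≤ x) (hεs : 0 ≤ εs) (hz'2 : 2 ≤ z')
    (hk : ((2 * rr + 1 : ℕ) : ℝ) * Real.log z' ≤ εs / 8 * Real.log x) :
    sieveMass z₁ z' (x ^ (εs / 8)) rr ≤ 4 * x ^ (3 * εs / 8) := by
  have hx0 : 0 < x := by linarith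
  have hz'0 : 0 < z' := by linarith
  have hzk : z' ^ (2 * rr + 1) ≤ x ^ (εs / 8) := by
    have h1 : Real.log (z' ^ (2 * rr + 1)) ≤ Real.log (x ^ (εs / 8)) := by
      rw [Real.log_pow, Real.log_rpow hx0]; exact hk
    exact (Real.log_le_log_iff (pow_pos hz'0 _) (Real.rpow_pos_of_pos hx0 _)).1 h1
  have hD1 : 1 ≤ x ^ (εs / 8) := Real.one_le_rpow hx1 (by positivity)
  have h1 : ((TwoRangeSieve.midPrimes z₁ z').card + 1 : ℝ) ^ (2 * rr + 1) ≤ x ^ (εs / 8) * x ^ (εs / 8) := by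
    calc ((TwoRangeSieve.midPrimes z₁ z').card + 1 : ℝ) ^ (2 * rr + 1) ≤ (2 * z') ^ (2 * rr + 1) :=
          pow_le_pow_left₀ (by positivity) (card_midPrimes_add_one_le hz'2) _
      _ = 2 ^ (2 * rr + 1) * z' ^ (2 * rr + 1) := mul_pow _ _ _
      _ ≤ z' ^ (2 * rr + 1) * z' ^ (2 * rr + 1) :=
          mul_le_mul_of_nonneg_right (pow_le_pow_left₀ (by norm_num) hz'2 _) (by positivity)
      _ ≤ x ^ (εs / 8) * x ^ (εs / 8) := mul_le_mul hzk hzk (by positivity) (Real.rpow_nonneg hx0.le _)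
  have h2 : x ^ (εs / 8) + 1 ≤ 2 * x ^ (εs / 8) := by linarith
  unfold sieveMass
  calc 2 * (x ^ (εs / 8) + 1) * ((TwoRangeSieve.midPrimes z₁ z').card + 1 : ℝ) ^ (2 * rr + 1)
      ≤ 2 * (2 * x ^ (εs / 8)) * (x ^ (εs / 8) * x ^ (εs / 8)) :=
        mul_le_mul (mul_le_mul_of_nonneg_left h2 (by norm_num)) h1 (by positivity) (by positivity)
    _ = 4 * x ^ (3 * εs / 8) := by
        rw [show (3 : ℝ) * εs / 8 = εs / 8 + (εs / 8 + εs / 8) by ring, Real.rpow_add hx0, Real.rpow_add hx0]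
        ring

/-- The level of the composite sieve: `D₁ z'^{2r+1} ≤ x^{ε_s/4}`. [folklore] -/
theorem sieveLevel_le {x εs z' : ℝ} {rr : ℕ} (hx1 : 1 ≤ x) (hz'2 : 2 ≤ z')
    (hk : ((2 * rr + 1 : ℕ) : ℝ) * Real.log z' ≤ εs / 8 * Real.log x) :
    x ^ (εs / 8) * z' ^ (2 * rr + 1) ≤ x ^ (εs / 4) := by
  have hx0 : 0 < x := by linarith
  have hz'0 : 0 < z' := by linarith
  have hzk : z' ^ (2 * rr + 1) ≤ x ^ (εs / 8) := by
    have h1 : Real.log (z' ^ (2 * rr + 1)) ≤ Real.log (x ^ (εs / 8)) := by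
      rw [Real.log_pow, Real.log_rpow hx0]; exact hk
    exact (Real.log_le_log_iff (pow_pos hz'0 _) (Real.rpow_pos_of_pos hx0 _)).1 h1
  calc x ^ (εs / 8) * z' ^ (2 * rr + 1) ≤ x ^ (εs / 8) * x ^ (εs / 8) :=
        mul_le_mul_of_nonneg_left hzk (Real.rpow_nonneg hx0.le _)
    _ = x ^ (εs / 4) := by rw [← Real.rpow_add hx0]; ring_nf

/-- `∑_{l ≤ L, (l,r)=1} 1_rough(l) ≤ L` (`L ≥ 0`). [folklore] -/
theorem sum_filter_rough_le {L : ℝ} (hL : 0 ≤ L) (z : ℝ) (r : ℕ) :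
    ∑ l ∈ (Icc 1 ⌊L⌋₊).filter (fun l : ℕ => l.Coprime r), roughIndicator z l ≤ L := by
  have h1 : ∀ l, roughIndicator z l ≤ 1 := fun l => by unfold roughIndicator; split_ifs <;> norm_num
  calc ∑ l ∈ (Icc 1 ⌊L⌋₊).filter (fun l : ℕ => l.Coprime r), roughIndicator z l
      ≤ ∑ l ∈ Icc 1 ⌊L⌋₊, roughIndicator z l :=
        Finset.sum_le_sum_of_subset_of_nonneg (Finset.filter_subset _ _) fun l _ _ => roughIndicator_nonneg z l
    _ ≤ ∑ _l ∈ Icc 1 ⌊L⌋₊, (1 : ℝ) := Finset.sum_le_sum fun l _ => h1 l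
    _ = ⌊L⌋₊ := by rw [Finset.sum_const, Nat.card_Icc, nsmul_eq_mul, mul_one]; push_cast; ring
    _ ≤ L := Nat.floor_le hL

/-- `∑_{l ≤ L', (l,r)=1} τ(l) 1_rough(l) ≤ 2 C_Λ L' (log x)⁴` for `1 ≤ L' ≤ x`, `x ≥ 2`, with the
constant of `∑_{n ≤ y} τ(n) ≤ C_Λ y log⁴ y`. [folklore] -/
theorem sum_filter_tau_rough_le {CΛ : ℝ} (hCΛ : 0 < CΛ)
    (hτ : ∀ y : ℝ, 2 ≤ y → ∑ n ∈ Icc 1 ⌊y⌋₊, (σ 0 n : ℝ) ^ 1 ≤ CΛ * y * Real.log y ^ (2 ^ (1 + 1)))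
    {x L' : ℝ} (hx2 : 2 ≤ x) (hL'1 : 1 ≤ L') (hL'x : L' ≤ x) (z : ℝ) (r : ℕ) :
    ∑ l ∈ (Icc 1 ⌊L'⌋₊).filter (fun l : ℕ => l.Coprime r), (σ 0 l : ℝ) * roughIndicator z l ≤
      2 * CΛ * L' * Real.log x ^ 4 := by
  have h1 : ∀ l, roughIndicator z l ≤ 1 := fun l => by unfold roughIndicator; split_ifs <;> norm_num
  set y : ℝ := max L' 2 with hy
  have hy2 : 2 ≤ y := le_max_right _ _
  have hyx : y ≤ x := max_le hL'x hx2
  have hyL : y ≤ 2 * L' := max_le (by linarith) (by linarith)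
  have hlogy0 : 0 ≤ Real.log y := Real.log_nonneg (by linarith)
  have hlogy : Real.log y ≤ Real.log x := Real.log_le_log (by linarith) hyx
  calc ∑ l ∈ (Icc 1 ⌊L'⌋₊).filter (fun l : ℕ => l.Coprime r), (σ 0 l : ℝ) * roughIndicator z l
      ≤ ∑ l ∈ Icc 1 ⌊L'⌋₊, (σ 0 l : ℝ) * roughIndicator z l :=
        Finset.sum_le_sum_of_subset_of_nonneg (Finset.filter_subset _ _) fun l _ _ =>
          mul_nonneg (Nat.cast_nonneg _) (roughIndicator_nonneg z l)
    _ ≤ ∑ l ∈ Icc 1 ⌊L'⌋₊, (σ 0 l : ℝ) ^ 1 := Finset.sum_le_sum fun l _ => by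
        rw [pow_one]
        calc (σ 0 l : ℝ) * roughIndicator z l ≤ (σ 0 l : ℝ) * 1 :=
              mul_le_mul_of_nonneg_left (h1 l) (Nat.cast_nonneg _)
          _ = _ := mul_one _
    _ ≤ ∑ l ∈ Icc 1 ⌊y⌋₊, (σ 0 l : ℝ) ^ 1 :=
        Finset.sum_le_sum_of_subset_of_nonneg (Finset.Icc_subset_Icc_right (Nat.floor_mono (le_max_left _ _)))
          fun l _ _ => by positivity
    _ ≤ CΛ * y * Real.log y ^ (2 ^ (1 + 1)) := hτ y hy2
    _ ≤ CΛ * (2 * L') * Real.log x ^ 4 := by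
        norm_num
        exact mul_le_mul (mul_le_mul_of_nonneg_left hyL hCΛ.le) (pow_le_pow_left₀ hlogy0 hlogy 4)
          (by positivity) (by positivity)
    _ = 2 * CΛ * L' * Real.log x ^ 4 := by ring

/-- `τ(l) 1_rough(l) ≤ C_τ x^{δ}` for `l ≤ L' ≤ x`, with the constant of the divisor bound
`τ(n) ≤ C_τ n^δ`. [folklore] -/
theorem tau_rough_le {Cτ δ : ℝ} (hCτ : 1 ≤ Cτ) (hδ : 0 < δ) (hτ : ∀ n : ℕ, (σ 0 n : ℝ) ≤ Cτ * (n : ℝ) ^ δ)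
    {x L' : ℝ} (hL'x : L' ≤ x) (z : ℝ) {l : ℕ} (hl : l ∈ Icc 1 ⌊L'⌋₊) :
    (σ 0 l : ℝ) * roughIndicator z l ≤ Cτ * x ^ δ := by
  have h1 : roughIndicator z l ≤ 1 := by unfold roughIndicator; split_ifs <;> norm_num
  rw [Finset.mem_Icc] at hl
  have hL'1 : (1 : ℝ) ≤ L' := Nat.floor_pos.mp (by omega)
  have hlx : (l : ℝ) ≤ x := ((Nat.cast_le.2 hl.2).trans (Nat.floor_le (by linarith))).trans hL'x
  calc (σ 0 l : ℝ) * roughIndicator z l ≤ (σ 0 l : ℝ) * 1 :=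
        mul_le_mul_of_nonneg_left h1 (Nat.cast_nonneg _)
    _ ≤ Cτ * (l : ℝ) ^ δ := by rw [mul_one]; exact hτ l
    _ ≤ Cτ * x ^ δ := mul_le_mul_of_nonneg_left (Real.rpow_le_rpow (Nat.cast_nonneg _) hlx hδ.le) (by linarith)

/-! ### The large-`x` facts -/

/-- The large-`x` facts of the assembly (one existential witness); `ℒ = log x`. [folklore] -/
theorem eventually7 {εs η : ℝ} (hεs : 0 < εs) (hη : 0 < η) (x₇ c₄ c₅ c₆ c₇ : ℝ) {A K₁ K₂ K₃ K₄ : ℝ}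
    (hA : 0 ≤ A) (hK₁ : 0 ≤ K₁) (hK₃ : 0 ≤ K₃) (hK₄ : 0 ≤ K₄) :
    ∃ x₀ : ℝ, ∀ x : ℝ, x₀ ≤ x →
      Real.exp (Real.exp 1) ≤ x ∧ x₇ ≤ x ∧ c₄ ≤ Real.log x ∧ c₅ ≤ Real.log (Real.log x) ∧
        c₆ ≤ Real.log (Real.log x) ∧ c₇ ≤ Real.log x ∧ K₂ ≤ Real.log x ∧
        K₁ * Real.log x ^ A ≤ x ^ η ∧ K₃ * Real.log x ^ (A + 36) ≤ x ^ (1 / 4 : ℝ) ∧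
        K₄ * Real.log x ^ (A + 36) ≤ x ^ (εs / 8) := by
  have hlog := Real.tendsto_log_atTop
  have hloglog := Real.tendsto_log_atTop.comp Real.tendsto_log_atTop
  have hpoly : ∀ {K p e : ℝ}, 0 ≤ K → 0 ≤ p → 0 < e →
      ∀ᶠ x : ℝ in Filter.atTop, K * Real.log x ^ p ≤ x ^ e := by
    intro K p e hK hp he
    obtain ⟨x₉, hx₉⟩ := exists_polylog_le_rpow hK hp he
    filter_upwards [Filter.eventually_ge_atTop x₉, Filter.eventually_ge_atTop 1] with x hx hx1
    have hL : 0 ≤ Real.log x := Real.log_nonneg hx1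
    exact le_trans (mul_le_mul_of_nonneg_left (Real.rpow_le_rpow hL (by linarith) hp) hK) (hx₉ x hx)
  have h1 : ∀ᶠ x : ℝ in Filter.atTop, Real.exp (Real.exp 1) ≤ x := Filter.eventually_ge_atTop _
  have h2 : ∀ᶠ x : ℝ in Filter.atTop, x₇ ≤ x := Filter.eventually_ge_atTop _
  have h4 : ∀ᶠ x : ℝ in Filter.atTop, c₄ ≤ Real.log x := hlog.eventually_ge_atTop _
  have h5 : ∀ᶠ x : ℝ in Filter.atTop, c₅ ≤ Real.log (Real.log x) := hloglog.eventually_ge_atTop _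
  have h6 : ∀ᶠ x : ℝ in Filter.atTop, c₆ ≤ Real.log (Real.log x) := hloglog.eventually_ge_atTop _
  have h7 : ∀ᶠ x : ℝ in Filter.atTop, c₇ ≤ Real.log x := hlog.eventually_ge_atTop _
  have h8 : ∀ᶠ x : ℝ in Filter.atTop, K₂ ≤ Real.log x := hlog.eventually_ge_atTop _
  have h9 : ∀ᶠ x : ℝ in Filter.atTop, K₁ * Real.log x ^ A ≤ x ^ η := hpoly hK₁ hA hη
  have h10 : ∀ᶠ x : ℝ in Filter.atTop, K₃ * Real.log x ^ (A + 36) ≤ x ^ (1 / 4 : ℝ) :=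
    hpoly hK₃ (by linarith) (by norm_num)
  have h11 : ∀ᶠ x : ℝ in Filter.atTop, K₄ * Real.log x ^ (A + 36) ≤ x ^ (εs / 8) :=
    hpoly hK₄ (by linarith) (by positivity)
  obtain ⟨x₀, hx₀⟩ := Filter.eventually_atTop.1 ((h1.and (h2.and h4)).and ((h5.and (h6.and h7)).and
    ((h8.and h9).and (h10.and h11))))
  refine ⟨x₀, fun x hx => ?_⟩
  obtain ⟨⟨a1, a2, a4⟩, ⟨a5, a6, a7⟩, ⟨a8, a9⟩, a10, a11⟩ := hx₀ x hx
  exact ⟨a1, a2, a4, a5, a6, a7, a8, a9, a10, a11⟩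

/-! ### The two savings -/

/-- A power-saving term is eventually `≤ x ℒ^{−A}/4`: if `K ℒ^A ≤ x^η` (`K ≥ 0`) and
`V ≤ (K/4) x^{1−η}`, then `V ≤ x/ℒ^A/4`. [folklore] -/
theorem power_saving_le {x ℒ A η K V : ℝ} (hx : 0 < x) (hℒ : 0 < ℒ)
    (hK : K * ℒ ^ A ≤ x ^ η) (hV : V ≤ K / 4 * x ^ (1 - η)) : V ≤ x / ℒ ^ A / 4 := by
  have hℒA : 0 < ℒ ^ A := Real.rpow_pos_of_pos hℒ A
  refine hV.trans ?_
  rw [div_div, le_div_iff₀ (by positivity)]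
  calc K / 4 * x ^ (1 - η) * (ℒ ^ A * 4) = (K * ℒ ^ A) * x ^ (1 - η) := by ring
    _ ≤ x ^ η * x ^ (1 - η) := mul_le_mul_of_nonneg_right hK (Real.rpow_nonneg hx.le _)
    _ = x := by rw [← Real.rpow_add hx]; norm_num

/-- A log-saving term is eventually `≤ x ℒ^{−A}/4`: if `V ≤ K x ℒ^{−A−1}` and `4K ≤ ℒ`, then
`V ≤ x/ℒ^A/4`. [folklore] -/
theorem log_saving_le {x ℒ A K V : ℝ} (hx : 0 < x) (hℒ : 0 < ℒ) (hK : 4 * K ≤ ℒ)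
    (hV : V ≤ K * x * ℒ ^ (-A - 1)) : V ≤ x / ℒ ^ A / 4 := by
  have hℒA : 0 < ℒ ^ A := Real.rpow_pos_of_pos hℒ A
  refine hV.trans ?_
  have hsplit : ℒ ^ (-A - 1) = (ℒ ^ A)⁻¹ * ℒ⁻¹ := by
    rw [show -A - 1 = -A + (-1) by ring, Real.rpow_add hℒ, Real.rpow_neg hℒ.le, Real.rpow_neg_one]
  rw [hsplit, div_div, le_div_iff₀ (by positivity)]
  calc K * x * ((ℒ ^ A)⁻¹ * ℒ⁻¹) * (ℒ ^ A * 4) = (4 * K) * x * ℒ⁻¹ * ((ℒ ^ A)⁻¹ * ℒ ^ A) := by ring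
    _ = (4 * K) * ℒ⁻¹ * x := by rw [inv_mul_cancel₀ hℒA.ne']; ring
    _ ≤ 1 * x := by
        refine mul_le_mul_of_nonneg_right ?_ hx.le
        rw [mul_inv_le_iff₀ hℒ, one_mul]; exact hK
    _ = x := one_mul x

/-- `x^a ≤ x^b` for `1 ≤ x`, `a ≤ b` (restated for `linarith`-friendly use). [folklore] -/
theorem rpow_le_rpow_of_le {x a b : ℝ} (hx : 1 ≤ x) (hab : a ≤ b) : x ^ a ≤ x ^ b :=
  Real.rpow_le_rpow_of_exponent_le hx hab

/-! ### The final numerics of the two cases -/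

/-- **Case A numerics** (`N ≤ x^{ε_s/2}`, one sandwich after merging `n` into `l`):
`3 T B_d N_w + Λ (M E₀ + 4 N_w) S ≤ x ℒ^{−A}` for `x` large. [folklore] -/
theorem caseA_final {x ℒ A εs ε₀ Cτ C₇ CΛ CS T Bd Nw Λ E₀ S L M N : ℝ} (hx1 : 1 < x)
    (hℒ1 : 1 ≤ ℒ) (hεs0 : 0 < εs) (hεs : εs ≤ ε₀ / 4)
    (hεs16 : εs ≤ 1 / 16) (hCτ : 1 ≤ Cτ) (hC₇ : 1 ≤ C₇) (hCΛ : 0 < CΛ) (hCS : 0 < CS)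
    (hT : T = Cτ * x ^ εs) (hBd : Bd = C₇ * x ^ (1 - ε₀)) (hNw0 : 0 ≤ Nw) (hNw : Nw ≤ 4 * x ^ (3 * εs / 8))
    (hΛ : Λ ≤ 2 * CΛ * (L * N) * ℒ ^ 4) (hE0 : 0 ≤ E₀) (hE : E₀ ≤ 10 * ℒ ^ (-(A + 38)))
    (hS0 : 0 ≤ S) (hS : S ≤ CS * (2 * ℒ) ^ 32) (hL1 : 1 ≤ L) (hLx : L ≤ x ^ (1 / 2 : ℝ)) (hN1 : 1 ≤ N)
    (hN : N ≤ x ^ (εs / 2)) (hM0 : 0 ≤ M) (hLMN : L * M * N = x)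
    (hK₁ : 4 * (12 * Cτ * C₇ + 144 * C₇) * ℒ ^ A ≤ x ^ (ε₀ / 2))
    (hK₂ : 2 ^ 40 * (CΛ * CS + CS + 1) ≤ ℒ) (hK₃ : 2 ^ 45 * (CΛ + 1) * CS * ℒ ^ (A + 36) ≤ x ^ (1 / 4 : ℝ)) :
    3 * (T * (Bd * Nw)) + Λ * 1 * (M * E₀ + 4 * Nw) * S ≤ x / ℒ ^ A := by
  have hx0 : 0 < x := by linarith
  have hx1' : 1 ≤ x := hx1.le
  have hℒ0 : 0 < ℒ := by linarith
  have hxe : ∀ t : ℝ, 0 < x ^ t := fun t => Real.rpow_pos_of_pos hx0 t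
  have hLN : L * N ≤ x ^ (1 / 2 + εs / 2) := by
    rw [Real.rpow_add hx0]; exact mul_le_mul hLx hN (by linarith) (hxe _).le
  have hLNM : L * N * M = x := by rw [← hLMN]; ring
  -- (A1) the main pieces
  have hA1 : 3 * (T * (Bd * Nw)) ≤ x / ℒ ^ A / 4 := by
    refine power_saving_le hx0 hℒ0 (K := 48 * Cτ * C₇) (η := ε₀ / 2) ?_ ?_
    · calc 48 * Cτ * C₇ * ℒ ^ A ≤ 4 * (12 * Cτ * C₇ + 144 * C₇) * ℒ ^ A := by
            refine mul_le_mul_of_nonneg_right ?_ (Real.rpow_nonneg hℒ0.le _); nlinarith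
        _ ≤ x ^ (ε₀ / 2) := hK₁
    · rw [hT, hBd]
      calc 3 * (Cτ * x ^ εs * (C₇ * x ^ (1 - ε₀) * Nw))
          ≤ 3 * (Cτ * x ^ εs * (C₇ * x ^ (1 - ε₀) * (4 * x ^ (3 * εs / 8)))) := by gcongr
        _ = 12 * Cτ * C₇ * (x ^ εs * x ^ (1 - ε₀) * x ^ (3 * εs / 8)) := by ring
        _ = 12 * Cτ * C₇ * x ^ (1 - ε₀ + 11 * εs / 8) := by
            rw [← Real.rpow_add hx0, ← Real.rpow_add hx0]; ring_nf
        _ ≤ 12 * Cτ * C₇ * x ^ (1 - ε₀ / 2) :=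
            mul_le_mul_of_nonneg_left (rpow_le_rpow_of_le hx1' (by linarith)) (by positivity)
        _ = 48 * Cτ * C₇ / 4 * x ^ (1 - ε₀ / 2) := by ring
  -- (A2) the Fundamental-Lemma remainder
  have hA2 : Λ * (M * E₀) * S ≤ x / ℒ ^ A / 4 := by
    refine log_saving_le hx0 hℒ0 (K := 20 * 2 ^ 32 * CΛ * CS) ?_ ?_
    · calc 4 * (20 * 2 ^ 32 * CΛ * CS) = 80 * 2 ^ 32 * (CΛ * CS) := by ring
        _ ≤ 2 ^ 40 * (CΛ * CS + CS + 1) := by nlinarith [mul_pos hCΛ hCS, hCS]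
        _ ≤ ℒ := hK₂
    · have h36 : ℒ ^ (4 : ℕ) * ℒ ^ (-(A + 38)) * ℒ ^ (32 : ℕ) = ℒ ^ (-A - 1) * ℒ⁻¹ := by
        rw [← Real.rpow_natCast, ← Real.rpow_natCast, ← Real.rpow_neg_one, ← Real.rpow_add hℒ0,
          ← Real.rpow_add hℒ0, ← Real.rpow_add hℒ0]
        norm_num; ring_nf
      have hℒinv : ℒ⁻¹ ≤ 1 := inv_le_one_of_one_le₀ hℒ1
      calc Λ * (M * E₀) * S ≤ (2 * CΛ * (L * N) * ℒ ^ 4) * (M * (10 * ℒ ^ (-(A + 38)))) * (CS * (2 * ℒ) ^ 32) := by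
            refine mul_le_mul (mul_le_mul hΛ (mul_le_mul_of_nonneg_left hE hM0) (by positivity)
              (by positivity)) hS hS0 (by positivity)
        _ = 20 * 2 ^ 32 * CΛ * CS * (L * N * M) * (ℒ ^ (4 : ℕ) * ℒ ^ (-(A + 38)) * ℒ ^ (32 : ℕ)) := by ring
        _ = 20 * 2 ^ 32 * CΛ * CS * x * ℒ ^ (-A - 1) * ℒ⁻¹ := by rw [hLNM, h36]; ring
        _ ≤ 20 * 2 ^ 32 * CΛ * CS * x * ℒ ^ (-A - 1) * 1 :=
            mul_le_mul_of_nonneg_left hℒinv (by positivity)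
        _ = 20 * 2 ^ 32 * CΛ * CS * x * ℒ ^ (-A - 1) := mul_one _
  -- (A3) the support term
  have hℒ36eq : ℒ ^ 4 * ℒ ^ 32 = ℒ ^ (36 : ℝ) := by
    rw [← pow_add, ← Real.rpow_natCast]; norm_num
  have hA3 : Λ * (4 * Nw) * S ≤ x / ℒ ^ A / 4 := by
    refine power_saving_le hx0 hℒ0 (K := 2 ^ 39 * CΛ * CS * ℒ ^ (36 : ℝ)) (η := 1 / 4) ?_ ?_
    · calc 2 ^ 39 * CΛ * CS * ℒ ^ (36 : ℝ) * ℒ ^ A = 2 ^ 39 * CΛ * CS * ℒ ^ (A + 36) := by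
            rw [mul_assoc, ← Real.rpow_add hℒ0, add_comm (36 : ℝ) A]
        _ ≤ 2 ^ 45 * (CΛ + 1) * CS * ℒ ^ (A + 36) := by
            refine mul_le_mul_of_nonneg_right ?_ (Real.rpow_nonneg hℒ0.le _); nlinarith [mul_pos hCΛ hCS]
        _ ≤ x ^ (1 / 4 : ℝ) := hK₃
    · have hexp : L * N * x ^ (3 * εs / 8) ≤ x ^ (1 - (1 : ℝ) / 4) := by
        calc L * N * x ^ (3 * εs / 8) ≤ x ^ (1 / 2 + εs / 2) * x ^ (3 * εs / 8) :=
              mul_le_mul_of_nonneg_right hLN (hxe _).le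
          _ = x ^ (1 / 2 + εs / 2 + 3 * εs / 8) := by rw [← Real.rpow_add hx0]
          _ ≤ x ^ (1 - (1 : ℝ) / 4) := rpow_le_rpow_of_le hx1' (by linarith)
      calc Λ * (4 * Nw) * S ≤ (2 * CΛ * (L * N) * ℒ ^ 4) * (4 * (4 * x ^ (3 * εs / 8))) * (CS * (2 * ℒ) ^ 32) := by
            refine mul_le_mul (mul_le_mul hΛ (by linarith) (by positivity) (by positivity)) hS hS0 (by positivity)
        _ = 2 ^ 37 * CΛ * CS * (ℒ ^ 4 * ℒ ^ 32) * (L * N * x ^ (3 * εs / 8)) := by ring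
        _ = 2 ^ 37 * CΛ * CS * ℒ ^ (36 : ℝ) * (L * N * x ^ (3 * εs / 8)) := by rw [hℒ36eq]
        _ ≤ 2 ^ 37 * CΛ * CS * ℒ ^ (36 : ℝ) * x ^ (1 - (1 : ℝ) / 4) :=
            mul_le_mul_of_nonneg_left hexp (by positivity)
        _ = 2 ^ 39 * CΛ * CS * ℒ ^ (36 : ℝ) / 4 * x ^ (1 - (1 : ℝ) / 4) := by ring
  have hsplit : Λ * 1 * (M * E₀ + 4 * Nw) * S = Λ * (M * E₀) * S + Λ * (4 * Nw) * S := by ring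
  rw [hsplit]
  have hW : 0 ≤ x / ℒ ^ A / 4 := by positivity
  linarith

/-- **Case B numerics** (`N > x^{ε_s/2}`, both variables sieved):
`9 N_w² B_d + L · Rem · S ≤ x ℒ^{−A}` for `x` large. [folklore] -/
theorem caseB_final {x ℒ A εs ε₀ C₇ CS Bd Nw E₀ S L M N : ℝ} (hx1 : 1 < x)
    (hℒ1 : 1 ≤ ℒ) (hεs0 : 0 < εs) (hεs : εs ≤ ε₀ / 4)
    (hεs16 : εs ≤ 1 / 16) (hC₇ : 1 ≤ C₇) (hCS : 0 < CS)
    (hBd : Bd = C₇ * x ^ (1 - ε₀)) (hNw0 : 0 ≤ Nw) (hNw : Nw ≤ 4 * x ^ (3 * εs / 8))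
    (hE0 : 0 ≤ E₀) (hE : E₀ ≤ 10 * ℒ ^ (-(A + 38))) (hE1 : E₀ ≤ 1)
    (hS0 : 0 ≤ S) (hS : S ≤ CS * (2 * ℒ) ^ 32) (hL1 : 1 ≤ L) (hLx : L ≤ x ^ (1 / 2 : ℝ))
    (hN : x ^ (εs / 2) < N) (hNM : N ≤ M) (hLMN : L * M * N = x)
    (hK₁ : 4 * (144 * C₇) * ℒ ^ A ≤ x ^ (ε₀ / 2)) (hK₂ : 2 ^ 40 * (CS + 1) ≤ ℒ)
    (hK₃ : 2 ^ 45 * CS * ℒ ^ (A + 36) ≤ x ^ (1 / 4 : ℝ)) (hK₄ : 2 ^ 45 * CS * ℒ ^ (A + 36) ≤ x ^ (εs / 8)) :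
    9 * 1 * Nw ^ 2 * Bd +
      L * (N * (M * E₀ + 4 * Nw) + 2 * ((M * (1 + E₀ / 2) + 2 * Nw) * (N * E₀ + 4 * Nw)) +
        (M * E₀ + 4 * Nw) * (N * E₀ + 4 * Nw)) * S ≤ x / ℒ ^ A := by
  have hx0 : 0 < x := by linarith
  have hx1' : 1 ≤ x := hx1.le
  have hℒ0 : 0 < ℒ := by linarith
  have hxe : ∀ t : ℝ, 0 < x ^ t := fun t => Real.rpow_pos_of_pos hx0 t
  have hN0 : 0 < N := (hxe _).trans hN
  have hM0 : 0 < M := hN0.trans_le hNM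
  have hℒ36 : ℒ ^ (32 + A) ≤ ℒ ^ (A + 36) := Real.rpow_le_rpow_of_exponent_le hℒ1 (by linarith)
  -- (B1) the main pieces
  have hB1 : 9 * 1 * Nw ^ 2 * Bd ≤ x / ℒ ^ A / 4 := by
    refine power_saving_le hx0 hℒ0 (K := 576 * C₇) (η := ε₀ / 2) ?_ ?_
    · calc 576 * C₇ * ℒ ^ A = 4 * (144 * C₇) * ℒ ^ A := by ring
        _ ≤ x ^ (ε₀ / 2) := hK₁
    · rw [hBd]
      calc 9 * 1 * Nw ^ 2 * (C₇ * x ^ (1 - ε₀)) ≤ 9 * 1 * (4 * x ^ (3 * εs / 8)) ^ 2 * (C₇ * x ^ (1 - ε₀)) := by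
            gcongr
        _ = 144 * C₇ * (x ^ (3 * εs / 8) * x ^ (3 * εs / 8) * x ^ (1 - ε₀)) := by ring
        _ = 144 * C₇ * x ^ (1 - ε₀ + 3 * εs / 4) := by
            rw [← Real.rpow_add hx0, ← Real.rpow_add hx0]; ring_nf
        _ ≤ 144 * C₇ * x ^ (1 - ε₀ / 2) :=
            mul_le_mul_of_nonneg_left (rpow_le_rpow_of_le hx1' (by linarith)) (by positivity)
        _ = 576 * C₇ / 4 * x ^ (1 - ε₀ / 2) := by ring
  -- the remainder, simplified: `Rem ≤ 5 MN E₀ + 28 M Nw + 32 Nw²`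
  have hRem : N * (M * E₀ + 4 * Nw) + 2 * ((M * (1 + E₀ / 2) + 2 * Nw) * (N * E₀ + 4 * Nw)) +
      (M * E₀ + 4 * Nw) * (N * E₀ + 4 * Nw) ≤ 5 * (M * N * E₀) + 28 * (M * Nw) + 32 * Nw ^ 2 := by
    have hexpand : N * (M * E₀ + 4 * Nw) + 2 * ((M * (1 + E₀ / 2) + 2 * Nw) * (N * E₀ + 4 * Nw)) +
        (M * E₀ + 4 * Nw) * (N * E₀ + 4 * Nw) =
        3 * (M * N * E₀) + 2 * (M * N * E₀ * E₀) + 4 * (N * Nw) + 8 * (M * Nw) + 8 * (M * Nw * E₀) +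
          8 * (N * Nw * E₀) + 32 * Nw ^ 2 := by ring
    rw [hexpand]
    have hMNE : 0 ≤ M * N * E₀ := by positivity
    have h1 : M * N * E₀ * E₀ ≤ M * N * E₀ := by
      calc M * N * E₀ * E₀ ≤ M * N * E₀ * 1 := mul_le_mul_of_nonneg_left hE1 hMNE
        _ = _ := mul_one _
    have h2 : N * Nw ≤ M * Nw := mul_le_mul_of_nonneg_right hNM hNw0
    have h3 : M * Nw * E₀ ≤ M * Nw := by
      calc M * Nw * E₀ ≤ M * Nw * 1 := mul_le_mul_of_nonneg_left hE1 (by positivity)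
        _ = _ := mul_one _
    have h4 : N * Nw * E₀ ≤ M * Nw := by
      calc N * Nw * E₀ ≤ N * Nw * 1 := mul_le_mul_of_nonneg_left hE1 (by positivity)
        _ = N * Nw := mul_one _
        _ ≤ M * Nw := h2
    linarith
  -- (B2a) `5 L M N E₀ S`
  have hB2a : L * (5 * (M * N * E₀)) * S ≤ x / ℒ ^ A / 4 := by
    refine log_saving_le hx0 hℒ0 (K := 50 * 2 ^ 32 * CS) ?_ ?_
    · calc 4 * (50 * 2 ^ 32 * CS) = 200 * 2 ^ 32 * CS := by ring
        _ ≤ 2 ^ 40 * (CS + 1) := by nlinarith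
        _ ≤ ℒ := hK₂
    · have h32 : ℒ ^ (-(A + 38)) * ℒ ^ (32 : ℕ) = ℒ ^ (-A - 1) * ℒ ^ (-(5 : ℝ)) := by
        rw [← Real.rpow_natCast, ← Real.rpow_add hℒ0, ← Real.rpow_add hℒ0]; norm_num; ring_nf
      have hℒ5 : ℒ ^ (-(5 : ℝ)) ≤ 1 := Real.rpow_le_one_of_one_le_of_nonpos hℒ1 (by norm_num)
      calc L * (5 * (M * N * E₀)) * S ≤ L * (5 * (M * N * (10 * ℒ ^ (-(A + 38))))) * (CS * (2 * ℒ) ^ 32) := by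
            refine mul_le_mul (mul_le_mul_of_nonneg_left (by gcongr) (by linarith)) hS hS0 (by positivity)
        _ = 50 * 2 ^ 32 * CS * (L * M * N) * (ℒ ^ (-(A + 38)) * ℒ ^ (32 : ℕ)) := by ring
        _ = 50 * 2 ^ 32 * CS * x * ℒ ^ (-A - 1) * ℒ ^ (-(5 : ℝ)) := by rw [hLMN, h32]; ring
        _ ≤ 50 * 2 ^ 32 * CS * x * ℒ ^ (-A - 1) * 1 := mul_le_mul_of_nonneg_left hℒ5 (by positivity)
        _ = 50 * 2 ^ 32 * CS * x * ℒ ^ (-A - 1) := mul_one _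
  -- (B2b) `28 L M Nw S = 28 x Nw / N · S`
  have hB2b : L * (28 * (M * Nw)) * S ≤ x / ℒ ^ A / 4 := by
    have hℒ32eq : ℒ ^ 32 = ℒ ^ (32 : ℝ) := by rw [← Real.rpow_natCast]; norm_num
    refine power_saving_le hx0 hℒ0 (K := 448 * 2 ^ 32 * CS * ℒ ^ (32 : ℝ)) (η := εs / 8) ?_ ?_
    · calc 448 * 2 ^ 32 * CS * ℒ ^ (32 : ℝ) * ℒ ^ A = 448 * 2 ^ 32 * CS * ℒ ^ (32 + A) := by
            rw [mul_assoc, ← Real.rpow_add hℒ0]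
        _ ≤ 2 ^ 45 * CS * ℒ ^ (A + 36) := by
            refine mul_le_mul (by nlinarith) hℒ36 (Real.rpow_nonneg hℒ0.le _) (by positivity)
        _ ≤ x ^ (εs / 8) := hK₄
    · -- `L M = x / N ≤ x · x^{−ε_s/2}`
      have hLM : L * M ≤ x * x ^ (-(εs / 2)) := by
        have hLM' : L * M = x / N := by rw [eq_div_iff hN0.ne']; exact hLMN
        rw [hLM', div_le_iff₀ hN0, mul_assoc]
        refine le_mul_of_one_le_right hx0.le ?_
        calc (1 : ℝ) = x ^ (-(εs / 2)) * x ^ (εs / 2) := by rw [← Real.rpow_add hx0]; norm_num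
          _ ≤ x ^ (-(εs / 2)) * N := mul_le_mul_of_nonneg_left hN.le (hxe _).le
      calc L * (28 * (M * Nw)) * S ≤ L * (28 * (M * (4 * x ^ (3 * εs / 8)))) * (CS * (2 * ℒ) ^ 32) := by
            refine mul_le_mul (mul_le_mul_of_nonneg_left (by gcongr) (by linarith)) hS hS0 (by positivity)
        _ = 112 * 2 ^ 32 * CS * ℒ ^ 32 * ((L * M) * x ^ (3 * εs / 8)) := by ring
        _ ≤ 112 * 2 ^ 32 * CS * ℒ ^ 32 * ((x * x ^ (-(εs / 2))) * x ^ (3 * εs / 8)) :=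
            mul_le_mul_of_nonneg_left (mul_le_mul_of_nonneg_right hLM (hxe _).le) (by positivity)
        _ = 112 * 2 ^ 32 * CS * ℒ ^ (32 : ℝ) * (x ^ (1 : ℝ) * x ^ (-(εs / 2)) * x ^ (3 * εs / 8)) := by
            rw [Real.rpow_one, hℒ32eq]
        _ = 112 * 2 ^ 32 * CS * ℒ ^ (32 : ℝ) * x ^ (1 + -(εs / 2) + 3 * εs / 8) := by
            rw [← Real.rpow_add hx0, ← Real.rpow_add hx0]
        _ = 112 * 2 ^ 32 * CS * ℒ ^ (32 : ℝ) * x ^ (1 - εs / 8) := by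
            congr 1; congr 1; ring
        _ = 448 * 2 ^ 32 * CS * ℒ ^ (32 : ℝ) / 4 * x ^ (1 - εs / 8) := by ring
  -- (B2c) `32 L Nw² S`
  have hB2c : L * (32 * Nw ^ 2) * S ≤ x / ℒ ^ A / 4 := by
    have hℒ32eq : ℒ ^ 32 = ℒ ^ (32 : ℝ) := by rw [← Real.rpow_natCast]; norm_num
    refine power_saving_le hx0 hℒ0 (K := 2 ^ 43 * CS * ℒ ^ (32 : ℝ)) (η := 1 / 4) ?_ ?_
    · calc 2 ^ 43 * CS * ℒ ^ (32 : ℝ) * ℒ ^ A = 2 ^ 43 * CS * ℒ ^ (32 + A) := by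
            rw [mul_assoc, ← Real.rpow_add hℒ0]
        _ ≤ 2 ^ 45 * CS * ℒ ^ (A + 36) := by
            refine mul_le_mul (by nlinarith) hℒ36 (Real.rpow_nonneg hℒ0.le _) (by positivity)
        _ ≤ x ^ (1 / 4 : ℝ) := hK₃
    · have hexp : x ^ (1 / 2 : ℝ) * (x ^ (3 * εs / 8) * x ^ (3 * εs / 8)) ≤ x ^ (1 - (1 : ℝ) / 4) := by
        rw [← Real.rpow_add hx0, ← Real.rpow_add hx0]
        exact rpow_le_rpow_of_le hx1' (by linarith)
      calc L * (32 * Nw ^ 2) * S ≤ x ^ (1 / 2 : ℝ) * (32 * (4 * x ^ (3 * εs / 8)) ^ 2) * (CS * (2 * ℒ) ^ 32) := by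
            refine mul_le_mul (mul_le_mul hLx (by gcongr) (by positivity) (hxe _).le) hS hS0 (by positivity)
        _ = 2 ^ 41 * CS * ℒ ^ 32 * (x ^ (1 / 2 : ℝ) * (x ^ (3 * εs / 8) * x ^ (3 * εs / 8))) := by ring
        _ ≤ 2 ^ 41 * CS * ℒ ^ 32 * x ^ (1 - (1 : ℝ) / 4) := mul_le_mul_of_nonneg_left hexp (by positivity)
        _ = 2 ^ 43 * CS * ℒ ^ (32 : ℝ) / 4 * x ^ (1 - (1 : ℝ) / 4) := by rw [hℒ32eq]; ring
  have hLS0 : 0 ≤ L * S := by positivity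
  calc 9 * 1 * Nw ^ 2 * Bd + L * (N * (M * E₀ + 4 * Nw) + 2 * ((M * (1 + E₀ / 2) + 2 * Nw) * (N * E₀ + 4 * Nw)) +
        (M * E₀ + 4 * Nw) * (N * E₀ + 4 * Nw)) * S
      = 9 * 1 * Nw ^ 2 * Bd + (L * S) * (N * (M * E₀ + 4 * Nw) +
          2 * ((M * (1 + E₀ / 2) + 2 * Nw) * (N * E₀ + 4 * Nw)) + (M * E₀ + 4 * Nw) * (N * E₀ + 4 * Nw)) := by
        ring
    _ ≤ 9 * 1 * Nw ^ 2 * Bd + (L * S) * (5 * (M * N * E₀) + 28 * (M * Nw) + 32 * Nw ^ 2) := by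
        have := mul_le_mul_of_nonneg_left hRem hLS0
        linarith
    _ = 9 * 1 * Nw ^ 2 * Bd + (L * (5 * (M * N * E₀)) * S + L * (28 * (M * Nw)) * S + L * (32 * Nw ^ 2) * S) := by
        ring
    _ ≤ x / ℒ ^ A / 4 + (x / ℒ ^ A / 4 + x / ℒ ^ A / 4 + x / ℒ ^ A / 4) := by linarith
    _ = x / ℒ ^ A := by ring

/-! ### Theorem 7* from Theorem 7 -/

set_option maxHeartbeats 1600000 in
/-- **Theorem 7* from Theorem 7, in the regime `Q²R ≤ x`** (BFI §14, p. 246: "As in Section 12,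
using Lemma 4 we can extend the result to sums `Δ*(M, N, L, Q, R)` … This gives THEOREM 7*").
Hypothesis: Theorem 7 for unsieved variables with a power saving — for every `a ≠ 0`, `ε > 0` there
are `ε₀ > 0`, `B`, `C`, `x₀` with `Δ(M, N, L, Q, R) ≤ C x^{1−ε₀}` for `x ≥ x₀`, `M, N, L, Q, R ≥ 1`,
`LMN = x`, `Q²R ≤ x`, `QR < x ℒ^{−B}`, (14.5) `LR < x^{1/2−ε}`, (14.6) `L^{1/2}R < M x^{−ε}` (this is
(14.1) in the regime of (14.4), which §14 obtains from Lemmas 1, 2).  Conclusion: the statement of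
`Literature.NumberTheory.Sieve.BombieriFriedlanderIwaniecTheorem7Star` in the same regime — for every
`a ≠ 0`, `ε > 0`, `A > 0` there are `B, C, x₀` with `Δ*(M, N, L, Q, R) ≤ C x ℒ^{−A}` for all
`z ≤ exp(log x/log log x)`.  Proof: `z ↦ max(z, 2)`; symmetry `M ↔ N`; Theorem 7 at `min(ε, 1/4)/2`;
two-range sieve of level `x^{ε_s/4}`, `ε_s = min(ε₀, ε, 1/4)/4` (`BFI.core_params`); for
`N > x^{ε_s/2}` both variables are sifted (`BFI.deltaW_rough_rough_le`, `BFI.caseB_final`), for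
`N ≤ x^{ε_s/2}` the variable `n` is merged into `l` (`BFI.deltaStar_le_deltaW_merge`) and `m` alone is
sifted (`BFI.deltaW_rough_le_sandwich`, `BFI.caseA_final`); the pieces are sums `Δ` at
`(M/d, N/e, L·de, Q, R)`, bounded by the hypothesis at `min(ε,1/4)/2`.
[cite: BombieriFriedlanderIwaniecActa1986, §14 Theorems 7, 7* p. 246; §12 p. 238] -/
theorem _root_.Literature.NumberTheory.Sieve.BombieriFriedlanderIwaniecTheorem7Star.restricted_of_smooth
    (h7 : ∀ a : ℤ, a ≠ 0 → ∀ ε : ℝ, 0 < ε → ∃ ε₀ B C x₀ : ℝ, 0 < ε₀ ∧ ∀ x : ℝ, x₀ ≤ x →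
      ∀ M N L Q R : ℝ, 1 ≤ M → 1 ≤ N → 1 ≤ L → 1 ≤ Q → 1 ≤ R → L * M * N = x →
      Q ^ 2 * R ≤ x → Q * R < x / Real.log x ^ B →
      L * R < x ^ (1 / 2 - ε) → L ^ (1 / 2 : ℝ) * R < M * x ^ (-ε) →
        deltaStar a 2 M N L Q R ≤ C * x ^ (1 - ε₀))
    {a : ℤ} (ha : a ≠ 0) {ε : ℝ} (hε : 0 < ε) {A : ℝ} (hA : 0 < A) :
    ∃ B C x₀ : ℝ, ∀ x : ℝ, x₀ ≤ x → ∀ M N L Q R : ℝ,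
      1 ≤ M → 1 ≤ N → 1 ≤ L → 1 ≤ Q → 1 ≤ R → L * M * N = x →
      Q ^ 2 * R ≤ x → Q * R < x / Real.log x ^ B →
      L * R < x ^ (1 / 2 - ε) → L ^ (1 / 2 : ℝ) * R < M * x ^ (-ε) →
      ∀ z : ℝ, z ≤ Real.exp (Real.log x / Real.log (Real.log x)) →
        deltaStar a z M N L Q R ≤ C * x / Real.log x ^ A := by
  classical
  -- the exponent actually used in (14.5)–(14.6) of the pieces
  set e : ℝ := min ε (1 / 4) with he_def
  have he0 : 0 < e := lt_min hε (by norm_num)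
  have heε : e ≤ ε := min_le_left _ _
  have he4 : e ≤ 1 / 4 := min_le_right _ _
  -- Theorem 7 at `e/2`
  obtain ⟨ε₀, B, C₇, x₇, hε₀, h7'⟩ := h7 a ha (e / 2) (half_pos he0)
  set C₇' : ℝ := max C₇ 1 with hC₇'def
  have hC₇'1 : 1 ≤ C₇' := le_max_right _ _
  have hC₇le : C₇ ≤ C₇' := le_max_left _ _
  -- the sieve exponent
  set εs : ℝ := min ε₀ e / 4 with hεs_def
  have hmin0 : 0 < min ε₀ e := lt_min hε₀ he0
  have hεs0 : 0 < εs := by rw [hεs_def]; positivity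
  have hεsε₀ : εs ≤ ε₀ / 4 := by have := min_le_left ε₀ e; rw [hεs_def]; linarith
  have hεse : εs ≤ e / 4 := by have := min_le_right ε₀ e; rw [hεs_def]; linarith
  have hεs16 : εs ≤ 1 / 16 := by linarith
  have hεs4 : εs ≤ 1 / 4 := by linarith
  -- constants: divisor bounds
  obtain ⟨Cτ, hCτ1, hτ⟩ := exists_sigma_zero_le_mul_rpow hεs0
  obtain ⟨CΛ, hCΛ, hΛτ⟩ := exists_sum_sigma_zero_pow_le_real 1
  obtain ⟨CS, hCS, hSle⟩ := sum_sum_sigma_sq_div_totient_le_log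
  -- the log exponent of the Fundamental Lemma and the large-`x` facts
  set A' : ℝ := A + 38 with hA'
  have hA'1 : 1 ≤ A' := by rw [hA']; linarith
  set K₁ : ℝ := 4 * (12 * Cτ * C₇' + 144 * C₇') with hK₁
  set K₂ : ℝ := 2 ^ 40 * (CΛ * CS + CS + 1) with hK₂
  set K₃ : ℝ := 2 ^ 45 * (CΛ + 1) * CS with hK₃
  set K₄ : ℝ := 2 ^ 45 * CS with hK₄
  obtain ⟨x₀, hx₀⟩ := eventually7 hεs0 (half_pos hε₀) x₇ ((80 * A' / εs) ^ 2) (16 / εs)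
    (16 / εs * (Real.exp 1 * Real.log (Real.exp 5 * (80 * A' / εs)) * Real.exp (16 * A' / εs) + 2))
    (2 * Real.exp 60) (A := A) (K₁ := K₁) (K₂ := K₂) (K₃ := K₃) (K₄ := K₄) hA.le
    (by positivity) (by positivity) (by positivity)
  refine ⟨B, 1, x₀, fun x hx M N L Q R hM hN hL hQ hR hLMN hQ2R hQR h5 h6 z hz => ?_⟩
  obtain ⟨hxee, hx₇, hc4, hc5, hc6, hc7, hK₂L, hK₁L, hK₃L, hK₄L⟩ := hx₀ x hx
  -- basic facts about `x`
  have he1 : (2.7 : ℝ) < Real.exp 1 := by have := Real.exp_one_gt_d9; linarith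
  have hx0 : 0 < x := (Real.exp_pos _).trans_le hxee
  set ℒ : ℝ := Real.log x with hℒdef
  have hℒe : Real.exp 1 ≤ ℒ := by rw [hℒdef, Real.le_log_iff_exp_le hx0]; exact hxee
  have hℒ1 : 1 ≤ ℒ := by linarith
  have hℒ0 : 0 < ℒ := by linarith
  have hx2 : 2 ≤ x := by
    have h1 : Real.exp 1 ≤ Real.exp (Real.exp 1) := Real.exp_le_exp.2 (by linarith)
    linarith
  have hx1 : 1 < x := by linarith
  have hx1' : 1 ≤ x := hx1.le
  have hxe : ∀ t : ℝ, 0 < x ^ t := fun t => Real.rpow_pos_of_pos hx0 t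
  have hCC : 1 ≤ CΛ * CS + CS + 1 := by nlinarith [mul_pos hCΛ hCS, hCS]
  have hℒ10 : 10 ≤ ℒ := by
    have : (10 : ℝ) ≤ K₂ := by
      rw [hK₂]
      calc (10 : ℝ) ≤ 2 ^ 40 * 1 := by norm_num
        _ ≤ 2 ^ 40 * (CΛ * CS + CS + 1) := mul_le_mul_of_nonneg_left hCC (by positivity)
    linarith
  -- `Q, R ≤ x`
  have hQx : Q ≤ x := by
    calc Q ≤ Q ^ 2 := by nlinarith
      _ ≤ Q ^ 2 * R := le_mul_of_one_le_right (sq_nonneg _) hR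
      _ ≤ x := hQ2R
  have hRx : R ≤ x := by
    calc R = 1 * R := (one_mul R).symm
      _ ≤ Q ^ 2 * R := mul_le_mul_of_nonneg_right (one_le_pow₀ hQ) (by linarith)
      _ ≤ x := hQ2R
  -- the log sum `S`
  set S : ℝ := ∑ r ∈ Icc 1 ⌊R⌋₊, ∑ q ∈ Icc 1 ⌊Q⌋₊, (σ 0 (q * r) : ℝ) ^ 2 / (Nat.totient (q * r) : ℝ) with hSdef
  have hS0 : 0 ≤ S := Finset.sum_nonneg fun _ _ => Finset.sum_nonneg fun _ _ => by positivity
  have hSx : S ≤ CS * (2 * ℒ) ^ 32 := by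
    refine (hSle Q R hQ hR).trans ?_
    have hq : 1 + Real.log Q ≤ 2 * ℒ := by
      have := Real.log_le_log (by linarith) hQx; linarith
    have hr : 1 + Real.log R ≤ 2 * ℒ := by
      have := Real.log_le_log (by linarith) hRx; linarith
    have hq0 : 0 ≤ 1 + Real.log Q := by linarith [Real.log_nonneg hQ]
    have hr0 : 0 ≤ 1 + Real.log R := by linarith [Real.log_nonneg hR]
    calc CS * (1 + Real.log Q) ^ 16 * (1 + Real.log R) ^ 16 ≤ CS * (2 * ℒ) ^ 16 * (2 * ℒ) ^ 16 := by
          gcongr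
      _ = CS * (2 * ℒ) ^ 32 := by ring
  -- the sifting range `z' = max z 2`
  set z' : ℝ := max z 2 with hz'def
  have hz'2 : 2 ≤ z' := le_max_right _ _
  have hz'1 : 1 ≤ z' := by linarith
  have hz'z0 : z' ≤ Real.exp (Real.log x / Real.log (Real.log x)) := max_le hz (two_le_z0 hxee)
  have hΔz : deltaStar a z' M N L Q R = deltaStar a z M N L Q R := by
    rw [hz'def]
    unfold deltaStar roughCongrCount roughCoprimeCount
    simp only [roughIndicator_max_two]
  have hρ0 : ∀ n, 0 ≤ roughIndicator z' n := roughIndicator_nonneg z'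
  have hρ1 : ∀ n, roughIndicator z' n ≤ 1 := fun n => by unfold roughIndicator; split_ifs <;> norm_num
  -- the sieve parameters
  obtain ⟨z₁, rr, lam, hz₁2, hz₁z, hD1, hzD, hlam, hk, hE⟩ :=
    core_params hεs0 hεs4 hA'1 hxee hc4 hc5 hc6 hc7 hz'2 hz'z0
  set D₁ : ℝ := x ^ (εs / 8) with hD₁
  have hE' : sieveErr z₁ z' D₁ lam rr ≤ 10 * ℒ ^ (-(A + 38)) := by unfold sieveErr; exact hE
  have hE0' : 0 ≤ sieveErr z₁ z' D₁ lam rr := sieveErr_nonneg _ _ _ hlam _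
  have hE1 : sieveErr z₁ z' D₁ lam rr ≤ 1 := by
    refine hE'.trans ?_
    have h1 : ℒ ^ (-(A + 38)) ≤ ℒ ^ (-(1 : ℝ)) := Real.rpow_le_rpow_of_exponent_le hℒ1 (by linarith)
    rw [Real.rpow_neg_one] at h1
    have h2 : 10 * ℒ⁻¹ ≤ 1 := by rw [mul_inv_le_iff₀ hℒ0, one_mul]; exact hℒ10
    linarith [mul_le_mul_of_nonneg_left h1 (by norm_num : (0 : ℝ) ≤ 10)]
  have hNw : sieveMass z₁ z' D₁ rr ≤ 4 * x ^ (3 * εs / 8) := sieveMass_le hx1' hεs0.le hz'2 hk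
  have hNw0 : 0 ≤ sieveMass z₁ z' D₁ rr := sieveMass_nonneg _ _ (by positivity) _
  have hD' : D₁ * z' ^ (2 * rr + 1) ≤ x ^ (εs / 4) := sieveLevel_le hx1' hz'2 hk
  -- Theorem 7 for the pieces
  have h7x : ∀ M' N' L' : ℝ, 1 ≤ M' → 1 ≤ N' → 1 ≤ L' → L' * M' * N' = x →
      L' * R < x ^ (1 / 2 - e / 2) → L' ^ (1 / 2 : ℝ) * R < M' * x ^ (-(e / 2)) →
      deltaStar a 2 M' N' L' Q R ≤ C₇' * x ^ (1 - ε₀) := by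
    intro M' N' L' hM' hN' hL' hprod h5' h6'
    exact (h7' x hx₇ M' N' L' Q R hM' hN' hL' hQ hR hprod hQ2R hQR h5' h6').trans
      (mul_le_mul_of_nonneg_right hC₇le (hxe _).le)
  set Bd : ℝ := C₇' * x ^ (1 - ε₀) with hBd
  have hBd0 : 0 ≤ Bd := by positivity
  -- the large-`x` facts in the shapes of the two cases
  have hK₁B : 4 * (144 * C₇') * ℒ ^ A ≤ x ^ (ε₀ / 2) := by
    refine le_trans (mul_le_mul_of_nonneg_right ?_ (Real.rpow_nonneg hℒ0.le _)) hK₁L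
    rw [hK₁]
    have : 0 ≤ 12 * Cτ * C₇' := by positivity
    linarith
  have hK₂B : 2 ^ 40 * (CS + 1) ≤ ℒ := by
    refine le_trans ?_ hK₂L
    rw [hK₂]
    have : 0 ≤ CΛ * CS := by positivity
    exact mul_le_mul_of_nonneg_left (by linarith) (by positivity)
  have hK₃B : 2 ^ 45 * CS * ℒ ^ (A + 36) ≤ x ^ (1 / 4 : ℝ) := by
    refine le_trans (mul_le_mul_of_nonneg_right ?_ (Real.rpow_nonneg hℒ0.le _)) hK₃L
    rw [hK₃]
    have h1 : (1 : ℝ) * CS ≤ (CΛ + 1) * CS := mul_le_mul_of_nonneg_right (by linarith) hCS.le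
    calc (2 : ℝ) ^ 45 * CS = 2 ^ 45 * (1 * CS) := by ring
      _ ≤ 2 ^ 45 * ((CΛ + 1) * CS) := mul_le_mul_of_nonneg_left h1 (by positivity)
      _ = 2 ^ 45 * (CΛ + 1) * CS := by ring
  -- THE CORE, for `N ≤ M`
  have core : ∀ M N L : ℝ, 1 ≤ M → 1 ≤ N → N ≤ M → 1 ≤ L → L * M * N = x →
      L * R < x ^ (1 / 2 - ε) → L ^ (1 / 2 : ℝ) * R < M * x ^ (-ε) →
      deltaStar a z' M N L Q R ≤ x / ℒ ^ A := by
    intro M N L hM hN hNM hL hLMN h5 h6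
    have hM0 : 0 ≤ M := by linarith
    have hN0 : 0 ≤ N := by linarith
    -- sizes of `L` and `M`
    have hLR1 : L ≤ L * R := le_mul_of_one_le_right (by linarith) hR
    have hLx : L ≤ x ^ (1 / 2 : ℝ) :=
      (hLR1.trans h5.le).trans (rpow_le_rpow_of_le hx1' (by linarith))
    have hM4 : x ^ (1 / 4 : ℝ) ≤ M := by
      by_contra hlt
      push Not at hlt
      have hMM : M * M < x ^ (1 / 4 : ℝ) * x ^ (1 / 4 : ℝ) := mul_lt_mul'' hlt hlt hM0 hM0
      rw [← Real.rpow_add hx0, show (1 / 4 : ℝ) + 1 / 4 = 1 / 2 by norm_num] at hMM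
      have hMN : M * N ≤ M * M := mul_le_mul_of_nonneg_left hNM hM0
      have : x < x := by
        calc x = L * (M * N) := by rw [← hLMN]; ring
          _ ≤ x ^ (1 / 2 : ℝ) * (M * M) := mul_le_mul hLx hMN (by positivity) (hxe _).le
          _ < x ^ (1 / 2 : ℝ) * x ^ (1 / 2 : ℝ) := mul_lt_mul_of_pos_left hMM (hxe _)
          _ = x := by rw [← Real.rpow_add hx0]; norm_num
      exact lt_irrefl _ this
    -- (14.5), (14.6) with `e ≤ ε`
    have h5e : L * R < x ^ (1 / 2 - e) := h5.trans_le (rpow_le_rpow_of_le hx1' (by linarith))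
    have h6e : L ^ (1 / 2 : ℝ) * R < M * x ^ (-e) :=
      h6.trans_le (mul_le_mul_of_nonneg_left (rpow_le_rpow_of_le hx1' (by linarith)) hM0)
    -- `d ≤ M` below the level
    have hdM : ∀ d : ℕ, (d : ℝ) < D₁ * z' ^ (2 * rr + 1) → (d : ℝ) ≤ M := fun d hdlt =>
      ((hdlt.trans_le hD').le.trans (rpow_le_rpow_of_le hx1' (by linarith))).trans hM4
    -- `x^{−ε_s/4} ≤ d⁻¹` below the level
    have hdinv : ∀ d : ℕ, 0 < d → (d : ℝ) < D₁ * z' ^ (2 * rr + 1) → x ^ (-(εs / 4)) ≤ ((d : ℝ))⁻¹ := by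
      intro d hd hdlt
      have hdpos : (0 : ℝ) < d := by exact_mod_cast hd
      rw [Real.rpow_neg hx0.le, inv_le_inv₀ (hxe _) hdpos]
      exact (hdlt.trans_le hD').le
    rcases le_or_gt N (x ^ (εs / 2)) with hNs | hNb
    · ------------------------------------------------------------------ Case A: `N ≤ x^{ε_s/2}`
      have hLN1 : 1 ≤ L * N := one_le_mul_of_one_le_of_one_le hL hN
      have hLNx : L * N ≤ x := by
        calc L * N ≤ x ^ (1 / 2 : ℝ) * x ^ (εs / 2) := mul_le_mul hLx hNs hN0 (hxe _).le
          _ = x ^ (1 / 2 + εs / 2) := by rw [← Real.rpow_add hx0]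
          _ ≤ x ^ (1 : ℝ) := rpow_le_rpow_of_le hx1' (by linarith)
          _ = x := Real.rpow_one x
      -- merge `n` into `l`, with the weight `τ · 1_rough` on `l' ≤ LN`
      have hmerge := deltaStar_le_deltaW_merge a z' M N L Q R
      set ωl : ℕ → ℝ := fun l' => (σ 0 l' : ℝ) * roughIndicator z' l' with hωl
      have hωl0 : ∀ l, 0 ≤ ωl l := fun l => mul_nonneg (Nat.cast_nonneg _) (hρ0 l)
      set T : ℝ := Cτ * x ^ εs with hT
      have hT0 : 0 ≤ T := by positivity
      have hωlT : ∀ l ∈ Icc 1 ⌊L * N⌋₊, ωl l ≤ T := fun l hl => tau_rough_le hCτ1 hεs0 hτ hLNx z' hl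
      set Λ : ℝ := 2 * CΛ * (L * N) * ℒ ^ 4 with hΛdef
      have hΛ : ∀ r : ℕ, ∑ l ∈ (Icc 1 ⌊L * N⌋₊).filter (fun l : ℕ => l.Coprime r), ωl l ≤ Λ :=
        fun r => sum_filter_tau_rough_le hCΛ hΛτ hx2 hLN1 hLNx z' r
      have hΛ0 : 0 ≤ Λ := by positivity
      -- the pieces: sums `Δ` at `(M/d, 1, LNd)`
      have hpieces : ∀ d : ℕ, 0 < d → (d : ℝ) < D₁ * z' ^ (2 * rr + 1) →
          deltaW a (M / d) 1 (L * N * d) Q R (fun _ => 1) (fun _ => 1) (roughIndicator z') ≤ Bd := by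
        intro d hd hdlt
        rw [deltaW_N_one_rough, deltaW_one_eq_deltaStar_two]
        have hdpos : (0 : ℝ) < d := by exact_mod_cast hd
        have hd1 : (1 : ℝ) ≤ d := by exact_mod_cast hd
        have hd4 : (d : ℝ) < x ^ (εs / 4) := hdlt.trans_le hD'
        have hM' : 1 ≤ M / d := by rw [le_div_iff₀ hdpos, one_mul]; exact hdM d hdlt
        have hL' : 1 ≤ L * N * d := one_le_mul_of_one_le_of_one_le hLN1 hd1
        have hprod : L * N * d * (M / d) * 1 = x := by
          rw [← hLMN]; field_simp
        have hNd : N * d < x ^ (εs / 2) * x ^ (εs / 4) := mul_lt_mul' hNs hd4 hdpos.le (hxe _)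
        rw [← Real.rpow_add hx0] at hNd
        have h5' : L * N * d * R < x ^ (1 / 2 - e / 2) := by
          calc L * N * d * R = (L * R) * (N * d) := by ring
            _ < x ^ (1 / 2 - e) * x ^ (εs / 2 + εs / 4) := mul_lt_mul'' h5e hNd (by positivity) (by positivity)
            _ = x ^ (1 / 2 - e + (εs / 2 + εs / 4)) := by rw [← Real.rpow_add hx0]
            _ ≤ x ^ (1 / 2 - e / 2) := rpow_le_rpow_of_le hx1' (by linarith)
        have h6' : (L * N * d) ^ (1 / 2 : ℝ) * R < M / d * x ^ (-(e / 2)) := by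
          have hsq : (L * N * d) ^ (1 / 2 : ℝ) = L ^ (1 / 2 : ℝ) * (N * d) ^ (1 / 2 : ℝ) := by
            rw [show L * N * d = L * (N * d) by ring, Real.mul_rpow (by linarith) (by positivity)]
          have hNd2 : (N * d) ^ (1 / 2 : ℝ) ≤ x ^ (3 * εs / 8) := by
            calc (N * d) ^ (1 / 2 : ℝ) ≤ (x ^ (εs / 2 + εs / 4)) ^ (1 / 2 : ℝ) :=
                  Real.rpow_le_rpow (by positivity) hNd.le (by norm_num)
              _ = x ^ (3 * εs / 8) := by rw [← Real.rpow_mul hx0.le]; ring_nf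
          calc (L * N * d) ^ (1 / 2 : ℝ) * R = (L ^ (1 / 2 : ℝ) * R) * (N * d) ^ (1 / 2 : ℝ) := by rw [hsq]; ring
            _ < (M * x ^ (-e)) * x ^ (3 * εs / 8) := mul_lt_mul h6e hNd2 (Real.rpow_pos_of_pos (by positivity) _)
                (by positivity)
            _ = M * x ^ (-e + 3 * εs / 8) := by rw [mul_assoc, ← Real.rpow_add hx0]
            _ ≤ M * x ^ (-(εs / 4) + -(e / 2)) :=
                mul_le_mul_of_nonneg_left (rpow_le_rpow_of_le hx1' (by linarith)) hM0
            _ = M * (x ^ (-(εs / 4)) * x ^ (-(e / 2))) := by rw [← Real.rpow_add hx0]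
            _ ≤ M * (((d : ℝ))⁻¹ * x ^ (-(e / 2))) :=
                mul_le_mul_of_nonneg_left (mul_le_mul_of_nonneg_right (hdinv d hd hdlt) (hxe _).le) hM0
            _ = M / d * x ^ (-(e / 2)) := by rw [div_eq_mul_inv]; ring
        exact h7x (M / d) 1 (L * N * d) hM' le_rfl hL' hprod h5' h6'
      -- the sandwich in `m` and the expansions
      have hsand := deltaW_rough_le_sandwich hz₁z D₁ rr hωl0 (fun n _ => hρ0 n) a M (L * N) Q R
        (ωn := roughIndicator z') (N := 1)
      have hPU := deltaW_sieveU_le hD1 hzD hz'1 hT0 hωl0 hωlT a hM0 1 Q R (roughIndicator z') hBd0 hpieces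
      have hPUL := deltaW_sieveUL_le hD1 hzD hz'1 hT0 hωl0 hωlT a hM0 1 Q R (roughIndicator z') hBd0 hpieces
      -- the remainder
      have hA₁ : ∀ k : ℕ, k ≠ 0 →
          0 ≤ ∑ n ∈ Icc 1 ⌊(1 : ℝ)⌋₊, roughIndicator z' n * (if n.Coprime k then (1 : ℝ) else 0) ∧
          ∑ n ∈ Icc 1 ⌊(1 : ℝ)⌋₊, roughIndicator z' n * (if n.Coprime k then (1 : ℝ) else 0) ≤ 1 * (σ 0 k : ℝ) :=
        fun k hk => sum_weight_coprime_bounds hρ0 hρ1 zero_le_one hk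
      have hBM : ∀ k : ℕ, k ≠ 0 → _ ∧ _ := fun k hk =>
        (sum_sieve_coprime_tau_bounds (rr := rr) hz₁2 hz₁z hD1 hzD hM0 hlam hk).1
      have hRem := remainder_le (a := a) (Q := Q) (R := R) hωl0 hΛ0 hΛ zero_le_one (by positivity) hA₁ hBM
      have htot : deltaStar a z' M N L Q R ≤ 3 * (T * (Bd * sieveMass z₁ z' D₁ rr)) +
          Λ * 1 * (M * sieveErr z₁ z' D₁ lam rr + 4 * sieveMass z₁ z' D₁ rr) * S := by
        refine hmerge.trans (hsand.trans ?_)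
        refine (add_le_add (add_le_add (mul_le_mul_of_nonneg_left hPU (by norm_num)) hPUL) hRem).trans ?_
        exact le_of_eq (by ring)
      exact htot.trans (caseA_final hx1 hℒ1 hεs0 hεsε₀ hεs16 hCτ1 hC₇'1 hCΛ hCS rfl rfl hNw0 hNw le_rfl hE0'
        hE' hS0 hSx hL hLx hN hNs hM0 hLMN hK₁L hK₂L hK₃L)
    · ------------------------------------------------------------------ Case B: `N > x^{ε_s/2}`
      have hNpos : 0 < N := by linarith
      -- the pieces: sums `Δ` at `(M/d, N/e, L e d)`
      have hpieces : ∀ d e' : ℕ, 0 < d → (d : ℝ) < D₁ * z' ^ (2 * rr + 1) →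
          0 < e' → (e' : ℝ) < D₁ * z' ^ (2 * rr + 1) →
          deltaW a (M / d) (N / e') (L * e' * d) Q R (fun _ => 1) (fun _ => 1) (fun _ => 1) ≤ Bd := by
        intro d e' hd hdlt he' helt
        rw [deltaW_one_eq_deltaStar_two]
        have hdpos : (0 : ℝ) < d := by exact_mod_cast hd
        have hepos : (0 : ℝ) < e' := by exact_mod_cast he'
        have hd1 : (1 : ℝ) ≤ d := by exact_mod_cast hd
        have he1' : (1 : ℝ) ≤ e' := by exact_mod_cast he'
        have hd4 : (d : ℝ) < x ^ (εs / 4) := hdlt.trans_le hD'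
        have he4 : (e' : ℝ) < x ^ (εs / 4) := helt.trans_le hD'
        have hM' : 1 ≤ M / d := by rw [le_div_iff₀ hdpos, one_mul]; exact hdM d hdlt
        have heN : (e' : ℝ) ≤ N := (he4.le.trans (rpow_le_rpow_of_le hx1' (by linarith))).trans hNb.le
        have hN' : 1 ≤ N / e' := by rw [le_div_iff₀ hepos, one_mul]; exact heN
        have hL' : 1 ≤ L * e' * d := one_le_mul_of_one_le_of_one_le (one_le_mul_of_one_le_of_one_le hL he1') hd1
        have hprod : L * e' * d * (M / d) * (N / e') = x := by
          rw [← hLMN]; field_simp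
        have hed : (e' : ℝ) * d < x ^ (εs / 4) * x ^ (εs / 4) := mul_lt_mul'' he4 hd4 hepos.le hdpos.le
        rw [← Real.rpow_add hx0] at hed
        have h5' : L * e' * d * R < x ^ (1 / 2 - e / 2) := by
          calc L * e' * d * R = (L * R) * (e' * d) := by ring
            _ < x ^ (1 / 2 - e) * x ^ (εs / 4 + εs / 4) := mul_lt_mul'' h5e hed (by positivity) (by positivity)
            _ = x ^ (1 / 2 - e + (εs / 4 + εs / 4)) := by rw [← Real.rpow_add hx0]
            _ ≤ x ^ (1 / 2 - e / 2) := rpow_le_rpow_of_le hx1' (by linarith)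
        have h6' : (L * e' * d) ^ (1 / 2 : ℝ) * R < M / d * x ^ (-(e / 2)) := by
          have hsq : (L * e' * d) ^ (1 / 2 : ℝ) = L ^ (1 / 2 : ℝ) * (e' * d) ^ (1 / 2 : ℝ) := by
            rw [show L * e' * d = L * (e' * d) by ring, Real.mul_rpow (by linarith) (by positivity)]
          have hed2 : ((e' : ℝ) * d) ^ (1 / 2 : ℝ) ≤ x ^ (εs / 4) := by
            calc ((e' : ℝ) * d) ^ (1 / 2 : ℝ) ≤ (x ^ (εs / 4 + εs / 4)) ^ (1 / 2 : ℝ) :=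
                  Real.rpow_le_rpow (by positivity) hed.le (by norm_num)
              _ = x ^ (εs / 4) := by rw [← Real.rpow_mul hx0.le]; ring_nf
          calc (L * e' * d) ^ (1 / 2 : ℝ) * R = (L ^ (1 / 2 : ℝ) * R) * (e' * d) ^ (1 / 2 : ℝ) := by rw [hsq]; ring
            _ < (M * x ^ (-e)) * x ^ (εs / 4) := mul_lt_mul h6e hed2 (Real.rpow_pos_of_pos (by positivity) _)
                (by positivity)
            _ = M * x ^ (-e + εs / 4) := by rw [mul_assoc, ← Real.rpow_add hx0]
            _ ≤ M * x ^ (-(εs / 4) + -(e / 2)) :=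
                mul_le_mul_of_nonneg_left (rpow_le_rpow_of_le hx1' (by linarith)) hM0
            _ = M * (x ^ (-(εs / 4)) * x ^ (-(e / 2))) := by rw [← Real.rpow_add hx0]
            _ ≤ M * (((d : ℝ))⁻¹ * x ^ (-(e / 2))) :=
                mul_le_mul_of_nonneg_left (mul_le_mul_of_nonneg_right (hdinv d hd hdlt) (hxe _).le) hM0
            _ = M / d * x ^ (-(e / 2)) := by rw [div_eq_mul_inv]; ring
        exact h7x (M / d) (N / e') (L * e' * d) hM' hN' hL' hprod h5' h6'
      -- the two-variable inequality
      have hmain := deltaW_rough_rough_le (a := a) (Q := Q) (R := R) hz₁2 hz₁z hD1 hzD hlam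
        (ωl := roughIndicator z') (T := 1) (Λ := L) (L := L) zero_le_one (by linarith) hρ0
        (fun l _ => hρ1 l) (fun r => sum_filter_rough_le (by linarith) z' r) hM0 hN0 hBd0 hpieces
      rw [deltaStar_eq_deltaW]
      exact hmain.trans (caseB_final hx1 hℒ1 hεs0 hεsε₀ hεs16 hC₇'1 hCS rfl hNw0 hNw hE0' hE' hE1 hS0 hSx
        hL hLx hNb hNM hLMN hK₁B hK₂B hK₃B hK₄L)
  -- conclusion: `z ↦ z'` and the symmetry `M ↔ N`
  rw [← hΔz, one_mul]
  rcases le_total N M with hNM | hMN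
  · exact core M N L hM hN hNM hL hLMN h5 h6
  · rw [deltaStar_comm]
    refine core N M L hN hM hMN hL (by rw [← hLMN]; ring) h5 ?_
    exact h6.trans_le (mul_le_mul_of_nonneg_right hMN (hxe _).le)


end BFI

end Literature.NumberTheory.Sieve
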